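import Summits.CriticalPhenomena.PercolationContinuityZ3.Theorems.PercNearOneGluingNoHeavyLowerTailKnQuestion8AntitheticPicture
import HarnessLib

/-!
# `NoHeavyLowerTail` (crux stmt-CriticalPhenomena-4575), antithetic vdBHK programme: ANTIPODAL KLEITMAN ALONG A FIBRATION OVER AN AK BASE (tool T13)

Support file (seat `prim-ineq-gen-7` gen 22; `--supports stmt-CriticalPhenomena-4575`).  Nothing is asserted about the crux; no `sorry`,
no definitions.  Memo: run/shared/lean/prim/prim-ineq-gen-7/FINDING-FIBRATION-g22.md §1.

SETTING (as in `…KnQuestion8AntitheticPicture`).  A finite preordered type `Ω` with a weight `μ ≥ 0` and an order-reversing `μ`-preserving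
involution `ι` is *antipodal Kleitman* (AK) if `Σ_u μ u · f u · (g u − g (ι u)) ≥ 0` for all monotone `f, g`; RAA / ULEX / MASTER⁺ of the memos are AK
statements for posets of edge 2-colourings of a rooted graph.  Tool T11 (`AntitheticPicture.ak_of_fibres`) proves AK from a map `π : Ω → T` whose
fibres are positively correlated and *sign coherent*.  Sign coherence fails exactly at 'touching' pictures (memo g20 §6, g21 §2); what survives
there is the weaker structure formalised here:

* `AntitheticFibration.fibreSum_comp` — reindexing a fibre sum by the involution: `Σ_{π u = p} μ u · f (ι u) = Σ_{π v = ι_T p} μ v · f v` when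
  `π ∘ ι = ι_T ∘ π`;
* `AntitheticFibration.ak_of_fibration` — **T13 (AK base change).**  Let `π : Ω → T` intertwine `ι` with an involution `ι_T` of a preordered base
  `T` whose fibre masses `ν p = Σ_{π u = p} μ u` are positive.  If (i) monotone functions are positively correlated on every fibre, (ii) the fibre
  AVERAGE `p ↦ (Σ_{π u = p} μ u · f u) / ν p` of every monotone `f` is monotone on `T` (the conditional laws increase along `T`), and (iii) the base
  `(T, ν, ι_T)` is AK, then `Ω` is AK.  Proof: symmetrise (`sum_mul_sub_eq_half`), split over fibres, fibre correlation bounds each fibre sum below by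
  `ν p · F̄ p · Ḡ p` with `F̄ = f̄ − f̄ ∘ ι_T` (by `fibreSum_comp`), and `Σ_p ν p F̄ p Ḡ p = 2 Σ_p ν p f̄ p (ḡ p − ḡ (ι_T p)) ≥ 0` by (iii).
T11 is the special case in which every `p` is comparable with `ι_T p` (then (iii) holds pointwise, `antipodalKleitman_of_comparable`), and the
'generic cube' reduction of memo g20 §6a is the case `T = 2^d` (`AntitheticProduct.antipodalKleitman_cube`).  In the language of memo g20 §3 (Fact 2):
RAA(Q;T) follows from AK of ANY picture poset on which the conditional laws are monotone — this file is that implication, kernel-checked.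
-/

namespace Summit.CriticalPhenomena.PercolationContinuityZ3.Theorems

open Finset

namespace AntitheticFibration

variable {Ω : Type*} [Fintype Ω] {T : Type*} [Fintype T] [DecidableEq T]

omit [Fintype T] in
/-- Reindexing a fibre sum by the involution: if `π (ι u) = ι_T (π u)`, `ι` is a `μ`-preserving involution and `ι_T` is an involution, then
`Σ_{π u = p} μ u · f (ι u) = Σ_{π v = ι_T p} μ v · f v`. [this work] -/
theorem fibreSum_comp (μ : Ω → ℝ) (ι : Ω → Ω) (hιι : Function.Involutive ι) (hμι : ∀ u, μ (ι u) = μ u)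
    (π : Ω → T) (ιT : T → T) (hιT : Function.Involutive ιT) (hπι : ∀ u, π (ι u) = ιT (π u)) (f : Ω → ℝ) (p : T) :
    ∑ u ∈ univ.filter (fun u => π u = p), μ u * f (ι u) = ∑ v ∈ univ.filter (fun v => π v = ιT p), μ v * f v := by
  classical
  -- the involution maps the fibre of `p` bijectively onto the fibre of `ι_T p`
  have himg : (univ.filter (fun u => π u = p)).image ι = univ.filter (fun v => π v = ιT p) := by
    ext v
    simp only [Finset.mem_image, Finset.mem_filter, Finset.mem_univ, true_and]
    constructor
    · rintro ⟨u, hu, rfl⟩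
      rw [hπι, hu]
    · intro hv
      refine ⟨ι v, ?_, hιι v⟩
      rw [hπι, hv, hιT p]
  rw [← himg, Finset.sum_image (fun x _ y _ h => hιι.injective h)]
  refine Finset.sum_congr rfl (fun u _ => ?_)
  rw [hμι]

/-- **T13 (antipodal Kleitman along a fibration over an AK base).**  `ι` an order-reversing `μ`-preserving involution of `Ω`; `π : Ω → T`
with `π ∘ ι = ι_T ∘ π` for an involution `ι_T` of the preordered base `T` preserving the (positive) fibre masses `ν p = Σ_{π u = p} μ u`.  Suppose
(i) on every fibre monotone functions are positively correlated, (ii) the fibre average of every monotone function is monotone on `T`, and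
(iii) the base `(T, ν, ι_T)` is antipodal Kleitman.  Then `Ω` is antipodal Kleitman.  (`μ ≥ 0` is not needed beyond what (i) and the positivity of
the fibre masses already encode.) [this work] -/
theorem ak_of_fibration [Preorder Ω] [Preorder T] (μ : Ω → ℝ) (ι : Ω → Ω) (hιι : Function.Involutive ι)
    (hμι : ∀ u, μ (ι u) = μ u) (hι : ∀ u v : Ω, u ≤ v → ι v ≤ ι u)
    (π : Ω → T) (ιT : T → T) (hιT : Function.Involutive ιT) (hπι : ∀ u, π (ι u) = ιT (π u))
    (ν : T → ℝ) (hν : ∀ p, ν p = ∑ u ∈ univ.filter (fun u => π u = p), μ u) (hνpos : ∀ p, 0 < ν p)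
    (hH : ∀ a b : Ω → ℝ, Monotone a → Monotone b → ∀ p : T,
      (∑ u ∈ univ.filter (fun u => π u = p), μ u * a u) * (∑ u ∈ univ.filter (fun u => π u = p), μ u * b u)
        ≤ (∑ u ∈ univ.filter (fun u => π u = p), μ u) * ∑ u ∈ univ.filter (fun u => π u = p), μ u * (a u * b u))
    (hMono : ∀ f : Ω → ℝ, Monotone f → Monotone (fun p : T => (∑ u ∈ univ.filter (fun u => π u = p), μ u * f u) / ν p))
    (hBase : ∀ a b : T → ℝ, Monotone a → Monotone b → 0 ≤ ∑ p, ν p * (a p * (b p - b (ιT p))))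
    (f g : Ω → ℝ) (hf : Monotone f) (hg : Monotone g) :
    0 ≤ ∑ u, μ u * (f u * (g u - g (ι u))) := by
  classical
  -- ν is ι_T-invariant (fibre of ι_T p is the ι-image of the fibre of p)
  have hνι : ∀ p, ν (ιT p) = ν p := by
    intro p
    have h := fibreSum_comp μ ι hιι hμι π ιT hιT hπι (fun _ => (1 : ℝ)) p
    simp only [mul_one] at h
    rw [hν, hν]
    exact h.symm
  -- fibre averages
  set fbar : T → ℝ := fun p => (∑ u ∈ univ.filter (fun u => π u = p), μ u * f u) / ν p with hfbar
  set gbar : T → ℝ := fun p => (∑ u ∈ univ.filter (fun u => π u = p), μ u * g u) / ν p with hgbar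
  have hfbm : Monotone fbar := hMono f hf
  have hgbm : Monotone gbar := hMono g hg
  -- symmetrise and split over fibres
  rw [AntitheticPicture.sum_mul_sub_eq_half μ ι hιι hμι f g]
  refine mul_nonneg (by norm_num) ?_
  set F : Ω → ℝ := fun u => f u - f (ι u) with hF
  set G : Ω → ℝ := fun u => g u - g (ι u) with hG
  have hFm : Monotone F := AntitheticPicture.monotone_sub_comp ι hι f hf
  have hGm : Monotone G := AntitheticPicture.monotone_sub_comp ι hι g hg
  rw [← Finset.sum_fiberwise_of_maps_to (s := (univ : Finset Ω)) (t := (univ : Finset T)) (g := π) (fun u _ => mem_univ _)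
    (fun u => μ u * ((f u - f (ι u)) * (g u - g (ι u))))]
  -- fibre sums of F and G in terms of the averages
  have hFsum : ∀ p, ∑ u ∈ univ.filter (fun u => π u = p), μ u * F u = ν p * (fbar p - fbar (ιT p)) := by
    intro p
    have h1 : ∑ u ∈ univ.filter (fun u => π u = p), μ u * F u
        = ∑ u ∈ univ.filter (fun u => π u = p), μ u * f u - ∑ u ∈ univ.filter (fun u => π u = p), μ u * f (ι u) := by
      rw [← Finset.sum_sub_distrib]
      refine Finset.sum_congr rfl (fun u _ => ?_)
      simp only [hF]; ring
    rw [h1, fibreSum_comp μ ι hιι hμι π ιT hιT hπι f p]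
    have hp : ν p ≠ 0 := ne_of_gt (hνpos p)
    simp only [hfbar]
    rw [hνι p, mul_sub, mul_div_cancel₀ _ hp, mul_div_cancel₀ _ hp]
  have hGsum : ∀ p, ∑ u ∈ univ.filter (fun u => π u = p), μ u * G u = ν p * (gbar p - gbar (ιT p)) := by
    intro p
    have h1 : ∑ u ∈ univ.filter (fun u => π u = p), μ u * G u
        = ∑ u ∈ univ.filter (fun u => π u = p), μ u * g u - ∑ u ∈ univ.filter (fun u => π u = p), μ u * g (ι u) := by
      rw [← Finset.sum_sub_distrib]
      refine Finset.sum_congr rfl (fun u _ => ?_)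
      simp only [hG]; ring
    rw [h1, fibreSum_comp μ ι hιι hμι π ιT hιT hπι g p]
    have hp : ν p ≠ 0 := ne_of_gt (hνpos p)
    simp only [hgbar]
    rw [hνι p, mul_sub, mul_div_cancel₀ _ hp, mul_div_cancel₀ _ hp]
  -- each fibre sum is at least ν p · F̄ p · Ḡ p
  have hfib : ∀ p, ν p * ((fbar p - fbar (ιT p)) * (gbar p - gbar (ιT p)))
      ≤ ∑ u ∈ univ.filter (fun u => π u = p), μ u * ((f u - f (ι u)) * (g u - g (ι u))) := by
    intro p
    have hc := hH F G hFm hGm p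
    rw [hFsum p, hGsum p, ← hν p] at hc
    -- hc : (ν p * ΔF) * (ν p * ΔG) ≤ ν p * Σ μ F G
    have hp : 0 < ν p := hνpos p
    have hc' : ν p * (ν p * ((fbar p - fbar (ιT p)) * (gbar p - gbar (ιT p))))
        ≤ ν p * ∑ u ∈ univ.filter (fun u => π u = p), μ u * (F u * G u) := by
      have := hc
      nlinarith [this]
    have := le_of_mul_le_mul_left hc' hp
    simpa [hF, hG] using this
  -- sum over the base and use AK of the base
  have hsum : ∑ p, ν p * ((fbar p - fbar (ιT p)) * (gbar p - gbar (ιT p)))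
      ≤ ∑ p, ∑ u ∈ univ.filter (fun u => π u = p), μ u * ((f u - f (ι u)) * (g u - g (ι u))) :=
    Finset.sum_le_sum (fun p _ => hfib p)
  refine le_trans ?_ hsum
  have h2 := AntitheticPicture.sum_mul_sub_eq_half ν ιT hιT hνι fbar gbar
  have hb := hBase fbar gbar hfbm hgbm
  linarith [hb, h2]

end AntitheticFibration

end Summit.CriticalPhenomena.PercolationContinuityZ3.Theorems
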